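import Summits.MatrixMultiplication.OmegaCensus.SmallFormats.MatMul22nRankGF7TorusCosets
import HarnessLib

/-!
# ω-census family (a): certificate format for the mod-7 relations among torus-coset counts of the `𝔽₇` X-cap system

Cell `pub-omega` (unit `pub-omega-tensor-g15`), topic `Summits/MatrixMultiplication/OmegaCensus` (sub-folder `SmallFormats`).
Framing (verbatim): lottery ticket; floor = certified bounds/negative ranges. HONEST FRAMING: kernel infrastructure (step R1 of
`pub-omega-tensor-g15/KERNEL-S4-DESIGN.md`: the format and its meaning; the 809 relation certificates are sibling data files);
nothing here is progress on `ω`.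

A RELATION is a functional `Σ_{u<882} a_u·P_u` on the 882 torus-coset counts `P_u = xrs7 x (cosetRow7 (u/42) (u%42))` with
coefficients `a_u = fld 3 A u ∈ [0,7)`. Its CERTIFICATE is a weight vector on the 392 TIGHT rows (`fld 3 W r`, `r < 384` the tangent
rows, `384 + k` the row-plane row `1266 + k`) such that the weighted tight rows and the functional's coset rows list every class the same
number of times modulo `7` — checked (`relOK7`) on the packed row-multiplicity vectors (`rowVec7`, base `2^24`) digit by digit. MEANING
(`rel7_of_relOK7`): at a point whose tangent rows equal `s` and whose row-plane rows equal `2s`, `Σ_u a_u·P_u ≡ s·κ(W) (mod 7)` with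
`κ(W) = Σ_{r<384} w_r + 2·Σ_{k<8} w_{384+k}` (`relConst7`). These are the 'hidden congruences' of the cell notes (g12 F7-TRANSFER, g14
METHOD-CONGRUENCE §2): over `𝔽₇` the coset counts of six tori determine all the others (g15 KERNEL-S4-DESIGN §1).
-/

namespace Summit.MatrixMultiplication.OmegaCensus.SmallFormats

open Finset
open Literature.NumberTheory.NumberFields (list_sum_range_map)

/-! ## The check -/

/-- Packed multiplicity vector of the weighted tight rows: `Σ_{r<384} w_r·rowVec7 r + Σ_{k<8} w_{384+k}·rowVec7 (1266+k)`. -/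
def relLhsVec7 (W : ℕ) : ℕ :=
  ((List.range 384).map fun r => fld 3 W r * rowVec7 r).sum + ((List.range 8).map fun k => fld 3 W (384 + k) * rowVec7 (1266 + k)).sum

/-- Packed multiplicity vector of the functional: `Σ_{u<882} a_u·rowVec7 (cosetRow7 (u/42) (u%42))`. -/
def relRhsVec7 (A : ℕ) : ℕ :=
  ((List.range 882).map fun u => fld 3 A u * rowVec7 (cosetRow7 (u / 42) (u % 42))).sum

/-- **Executable certificate check:** the two packed vectors agree digit by digit modulo `7` (digits = classes `< 400`). -/
def relOK7 (A W : ℕ) : Bool :=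
  (List.range 400).all fun c => fld 24 (relLhsVec7 W) c % 7 == fld 24 (relRhsVec7 A) c % 7

/-- The constant of the relation: `κ(W) = Σ_{r<384} w_r + 2·Σ_{k<8} w_{384+k}`. -/
def relConst7 (W : ℕ) : ℕ := ∑ r ∈ range 384, fld 3 W r + 2 * ∑ k ∈ range 8, fld 3 W (384 + k)

/-- The value of the functional at the point `x`: `Σ_{u<882} a_u · P_u`. -/
def relVal7 (A : ℕ) (x : ℕ → ℕ) : ℤ := ∑ u ∈ range 882, (fld 3 A u : ℤ) * xrs7 x (cosetRow7 (u / 42) (u % 42))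

/-! ## Meaning -/

/-- `fld 3` values are `< 8`. -/
theorem fld3_lt (N i : ℕ) : fld 3 N i < 8 := by
  unfold fld; exact Nat.lt_succ_of_le Nat.and_le_right

/-- `fld 24` reads base-`2^24` digits. -/
theorem fld24_eq (N c : ℕ) : fld 24 N c = N / 2 ^ (24 * c) % 2 ^ 24 := by
  unfold fld; rw [Nat.and_two_pow_sub_one_eq_mod, Nat.shiftRight_eq_div_pow]

/-- Coefficient (multiplicity of class `c`) of the weighted tight rows. -/
def relLhsCnt7 (W c : ℕ) : ℕ := ∑ r ∈ range 384, fld 3 W r * cnt7 r c + ∑ k ∈ range 8, fld 3 W (384 + k) * cnt7 (1266 + k) c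
/-- Coefficient of class `c` in the functional's coset rows. -/
def relRhsCnt7 (A c : ℕ) : ℕ := ∑ u ∈ range 882, fld 3 A u * cnt7 (cosetRow7 (u / 42) (u % 42)) c

/-- Coset rows are rows `< 1274`. -/
theorem cosetRow7_lt (u : ℕ) (hu : u < 882) : cosetRow7 (u / 42) (u % 42) < 1274 := by
  have h := cosetRow7_range ⟨u / 42, by omega⟩ ⟨u % 42, Nat.mod_lt _ (by norm_num)⟩
  exact lt_trans h.2 (by norm_num)

/-- The left packed vector packs the left coefficients. -/
theorem relLhsVec7_eq (W : ℕ) : relLhsVec7 W = pack24 (relLhsCnt7 W) 400 := by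
  unfold relLhsVec7 relLhsCnt7
  have h1 : ((List.range 384).map fun r => fld 3 W r * rowVec7 r).sum = pack24 (fun c => ∑ r ∈ range 384, fld 3 W r * cnt7 r c) 400 := by
    rw [pack24_sum, list_sum_range_map]
    refine sum_congr rfl fun r hr => ?_
    rw [rowVec7_eq_pack24 (by have := mem_range.1 hr; omega), ← pack24_smul]
  have h2 : ((List.range 8).map fun k => fld 3 W (384 + k) * rowVec7 (1266 + k)).sum
      = pack24 (fun c => ∑ k ∈ range 8, fld 3 W (384 + k) * cnt7 (1266 + k) c) 400 := by
    rw [pack24_sum, list_sum_range_map]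
    refine sum_congr rfl fun k hk => ?_
    rw [rowVec7_eq_pack24 (by have := mem_range.1 hk; omega), ← pack24_smul]
  rw [h1, h2]
  exact (pack24_add _ _ 400).symm.trans rfl

/-- The right packed vector packs the right coefficients. -/
theorem relRhsVec7_eq (A : ℕ) : relRhsVec7 A = pack24 (relRhsCnt7 A) 400 := by
  unfold relRhsVec7 relRhsCnt7
  rw [pack24_sum, list_sum_range_map]
  refine sum_congr rfl fun u hu => ?_
  rw [rowVec7_eq_pack24 (cosetRow7_lt u (mem_range.1 hu)), ← pack24_smul]

/-- Bounds on the coefficients (digits stay below `2^24`). -/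
theorem relCnt7_lt (A W c : ℕ) : relLhsCnt7 W c < 2 ^ 24 ∧ relRhsCnt7 A c < 2 ^ 24 := by
  constructor
  · unfold relLhsCnt7
    have h1 : ∑ r ∈ range 384, fld 3 W r * cnt7 r c ≤ ∑ r ∈ range 384, 7 * 8 :=
      sum_le_sum fun r _ => Nat.mul_le_mul (by have := fld3_lt W r; omega) (cnt7_le r c)
    have h2 : ∑ k ∈ range 8, fld 3 W (384 + k) * cnt7 (1266 + k) c ≤ ∑ k ∈ range 8, 7 * 8 :=
      sum_le_sum fun k _ => Nat.mul_le_mul (by have := fld3_lt W (384 + k); omega) (cnt7_le _ c)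
    rw [sum_const, card_range, smul_eq_mul] at h1 h2; omega
  · unfold relRhsCnt7
    have h1 : ∑ u ∈ range 882, fld 3 A u * cnt7 (cosetRow7 (u / 42) (u % 42)) c ≤ ∑ u ∈ range 882, 7 * 8 :=
      sum_le_sum fun u _ => Nat.mul_le_mul (by have := fld3_lt A u; omega) (cnt7_le _ c)
    rw [sum_const, card_range, smul_eq_mul] at h1; omega

/-- A passing check gives the coefficient congruences class by class. -/
theorem relCnt7_congr {A W : ℕ} (h : relOK7 A W = true) {c : ℕ} (hc : c < 400) :
    (relLhsCnt7 W c : ℤ) % 7 = (relRhsCnt7 A c : ℤ) % 7 := by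
  unfold relOK7 at h
  have h1 := List.all_eq_true.1 h c (List.mem_range.2 hc)
  rw [beq_iff_eq, fld24_eq, fld24_eq, relLhsVec7_eq, relRhsVec7_eq,
    pack24_digit _ (fun i _ => (relCnt7_lt A W i).1) hc, pack24_digit _ (fun i _ => (relCnt7_lt A W i).2) hc] at h1
  exact_mod_cast congrArg (fun n : ℕ => (n : ℤ)) h1

/-- **Meaning of a relation certificate.** If `relOK7 A W` passes then at every point whose tangent rows equal `s` and whose row-plane
rows equal `2s`: `Σ_u a_u·P_u ≡ s·κ(W) (mod 7)`. -/
theorem rel7_of_relOK7 {A W : ℕ} (h : relOK7 A W = true) (s : ℕ) (x : ℕ → ℕ)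
    (hT : ∀ r < 384, xrs7 x r = s) (hR : ∀ k < 8, xrs7 x (1266 + k) = 2 * (s : ℤ)) :
    relVal7 A x % 7 = ((s : ℤ) * relConst7 W) % 7 := by
  -- both sides as class sums
  have hrow : ∀ r < 1274, xrs7 x r = ∑ c ∈ range 400, (cnt7 r c : ℤ) * (x c : ℤ) := fun r hr => xrs7_eq_sum x hr
  have hL : ∑ r ∈ range 384, (fld 3 W r : ℤ) * xrs7 x r + ∑ k ∈ range 8, (fld 3 W (384 + k) : ℤ) * xrs7 x (1266 + k)
      = ∑ c ∈ range 400, (relLhsCnt7 W c : ℤ) * (x c : ℤ) := by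
    have e1 : ∀ r ∈ range 384, (fld 3 W r : ℤ) * xrs7 x r = ∑ c ∈ range 400, ((fld 3 W r : ℤ) * (cnt7 r c : ℤ)) * (x c : ℤ) := by
      intro r hr; rw [hrow r (by have := mem_range.1 hr; omega), mul_sum]
      exact sum_congr rfl fun c _ => by ring
    have e2 : ∀ k ∈ range 8, (fld 3 W (384 + k) : ℤ) * xrs7 x (1266 + k)
        = ∑ c ∈ range 400, ((fld 3 W (384 + k) : ℤ) * (cnt7 (1266 + k) c : ℤ)) * (x c : ℤ) := by
      intro k hk; rw [hrow (1266 + k) (by have := mem_range.1 hk; omega), mul_sum]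
      exact sum_congr rfl fun c _ => by ring
    rw [sum_congr rfl e1, sum_congr rfl e2, sum_comm, sum_comm (s := range 8), ← sum_add_distrib]
    refine sum_congr rfl fun c _ => ?_
    have e : (relLhsCnt7 W c : ℤ) = ∑ r ∈ range 384, (fld 3 W r : ℤ) * (cnt7 r c : ℤ)
        + ∑ k ∈ range 8, (fld 3 W (384 + k) : ℤ) * (cnt7 (1266 + k) c : ℤ) := by
      unfold relLhsCnt7; push_cast; ring
    rw [← sum_mul, ← sum_mul, ← add_mul, e]
  have hRv : relVal7 A x = ∑ c ∈ range 400, (relRhsCnt7 A c : ℤ) * (x c : ℤ) := by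
    unfold relVal7
    have e : ∀ u ∈ range 882, (fld 3 A u : ℤ) * xrs7 x (cosetRow7 (u / 42) (u % 42))
        = ∑ c ∈ range 400, ((fld 3 A u : ℤ) * (cnt7 (cosetRow7 (u / 42) (u % 42)) c : ℤ)) * (x c : ℤ) := by
      intro u hu; rw [hrow _ (cosetRow7_lt u (mem_range.1 hu)), mul_sum]
      exact sum_congr rfl fun c _ => by ring
    rw [sum_congr rfl e, sum_comm]
    refine sum_congr rfl fun c _ => ?_
    have e' : (relRhsCnt7 A c : ℤ) = ∑ u ∈ range 882, (fld 3 A u : ℤ) * (cnt7 (cosetRow7 (u / 42) (u % 42)) c : ℤ) := by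
      unfold relRhsCnt7; push_cast; ring
    rw [← sum_mul, e']
  -- the left side evaluates to s·κ at the point
  have hLval : ∑ r ∈ range 384, (fld 3 W r : ℤ) * xrs7 x r + ∑ k ∈ range 8, (fld 3 W (384 + k) : ℤ) * xrs7 x (1266 + k)
      = (s : ℤ) * relConst7 W := by
    have e1 : ∑ r ∈ range 384, (fld 3 W r : ℤ) * xrs7 x r = ∑ r ∈ range 384, (fld 3 W r : ℤ) * (s : ℤ) :=
      sum_congr rfl fun r hr => by rw [hT r (mem_range.1 hr)]
    have e2 : ∑ k ∈ range 8, (fld 3 W (384 + k) : ℤ) * xrs7 x (1266 + k)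
        = ∑ k ∈ range 8, (fld 3 W (384 + k) : ℤ) * (2 * (s : ℤ)) :=
      sum_congr rfl fun k hk => by rw [hR k (mem_range.1 hk)]
    have e3 : ((relConst7 W : ℕ) : ℤ) = ∑ r ∈ range 384, (fld 3 W r : ℤ) + 2 * ∑ k ∈ range 8, (fld 3 W (384 + k) : ℤ) := by
      unfold relConst7; push_cast; ring
    rw [e1, e2, e3, ← sum_mul, ← sum_mul]; ring
  -- termwise congruence
  rw [hRv, ← hLval, hL, Int.emod_eq_emod_iff_emod_sub_eq_zero, ← sum_sub_distrib]
  apply Int.emod_eq_zero_of_dvd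
  apply dvd_sum
  intro c hc
  rw [← sub_mul]
  exact Dvd.dvd.mul_right (Int.ModEq.dvd (relCnt7_congr h (mem_range.1 hc))) _

end Summit.MatrixMultiplication.OmegaCensus.SmallFormats
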